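import Summits.ABC.IUTFork.Thm311RealInd2IsmRigid
import HarnessLib

/-!
# [IUTchIII] Theorem 3.11 (i) (Ind2), print-literal at `𝕍^non`: PRINT'S Ism ACTS ON THE LOG-LATTICE AS A SCALAR
# MODULO EVERY `n` — NO LATTICE SHEAR (Hensel's lemma supplies the openness input of the norm-rigidity theorem)

Record file (D-0012) of the abc-iut cell (seat abc-iut-c312-1, holder of record of the typed [IUTchIII] Thm. 3.11,
gen 7); sequel of `Thm311RealInd2IsmRigid.lean`; TAKES NO SIDE on [IUTchIII] Cor. 3.12.

`Thm311RealInd2IsmRigid` proved: an automorphism `ψ : K_v ⥲ K_v` induced (through a logarithm `L` on `𝒪_v^×`) by a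
`G_v`-ISOMETRY of [IUTchII] Ex. 1.8 (iv) fixes, as a set, every additive subgroup `M ⊆ Λ := L(𝒪_v^×)` whose unit
preimage `{u : L u ∈ M}` has open image in `K_v^×` (norm rigidity + the units form of the local existence theorem).
THIS FILE removes the openness binder for the sub-lattices that matter:

* `Real.isOpen_map_range_powMonoidHom` — **`(𝒪_v^×)^n` is OPEN in `K_v^×`** (`n ≠ 0`): by Hensel's lemma in the
  complete DVR `𝒪_v` (the tree's `adicCompletionIntegers.henselianLocalRing` and `exists_units_pow_eq_one_add`:
  `1 + n²𝔪 ⊆ (𝒪_v^×)^n`), so `(𝒪_v^×)^n` contains the neighbourhood `{|x − 1| < |n²|}` of `1`;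
* **`Real.image_eq_of_realises_of_nsmul_mem`** — for EVERY additive subgroup `M` with `n·Λ ⊆ M ⊆ Λ` (`n ≠ 0`):
  `ψ(M) = M` — print's (Ind2) FIXES EVERY sub-lattice of the log-lattice between `n·Λ` and `Λ`;
* **`Real.exists_zsmul_add_nsmul_of_realises`** — hence for every unit `u` and every `n ≠ 0` there are `k ∈ ℤ` and a
  unit `u'` with `ψ(L u) = k·L(u) + n·L(u')`: **`ψ ≡ k (mod n·Λ)` on each direction of the log-lattice** — `ψ` induces
  on `Λ ⧸ nΛ` a map preserving every cyclic subgroup (for `Λ ≅ ℤ_p^d` a SCALAR), so the (Ind2)-orbit of a lattice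
  region under PRINT's group is the region itself modulo `n` for every `n`: the lattice SHEARS of Dupuy–Hilado's
  `Aut_{ℚ_p}(K_v : I_v)` (c312-5 `Real.ismDH`; e.g. the mover `1 ↦ π/p` of abc-iut-c312-3's shallow-ramified licence,
  the hull inflation F-c312-5-g4-1) are not available under print's reading of (Ind2), while every `∀`-clause and
  every countermodel over `ismDH` still transfers (`Real.ismIsm_subset_ismDH`).

HONEST SCOPE: theorems about OUR typed objects + classical facts (LCFT existence theorem, Hensel); Mochizuki's `Ism` is
read with topologies suppressed as abc-iut-L6-t2 typed it (continuity is ADDED by the realisation, never used here: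
the rigidity is purely algebraic); nothing asserts or refutes [IUTchIII] Cor. 3.12; no side taken.
[claim: Mochizuki2012, status: disputed] for the quotations; [cite: SerreLocalFields1979, Ch. XIV §6 Thm. 1];
[cite: NeukirchANT1999, Ch. II (4.6)] (Hensel). typed ≠ proved; instantiated ≠ endorsed.
-/

set_option autoImplicit false

noncomputable section

namespace Summit.ABC.IUTFork.Thm311.Real

open NumberField IsDedekindDomain Literature.IUT.LogVolume Literature.IUT.LogThetaLattice
open Literature.AnabelianGeometry.AbsoluteAnabelian Literature.IUT.HodgeArakelov
open Literature.NumberTheory.GaloisRepresentations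

variable {F : Type} [Field F] [NumberField F] (v : HeightOneSpectrum (𝓞 F))

/-! ## 1. Hensel: `(𝒪_v^×)^n` is open in `K_v^×` -/

/-- **`(𝒪_v^×)^n` is an OPEN subgroup of `K_v^×`** (`n ≠ 0`; characteristic `0`): it contains the neighbourhood
`{x : |x − 1|_v < |n²|_v}` of `1`, every element `1 + n² w`, `|w|_v < 1`, of which is an `n`-th power of a unit by
Hensel's lemma in the complete discrete valuation ring `𝒪_v` (the tree's `exists_units_pow_eq_one_add` over
`adicCompletionIntegers.henselianLocalRing`). [cite: NeukirchANT1999, Ch. II (4.6)] -/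
theorem isOpen_map_range_powMonoidHom {n : ℕ} (hn : n ≠ 0) :
    IsOpen ((((powMonoidHom n : (↥(v.adicCompletionIntegers F))ˣ →* (↥(v.adicCompletionIntegers F))ˣ).range).map
      (unitsToK v) : Subgroup (v.adicCompletion F)ˣ) : Set (v.adicCompletion F)ˣ) := by
  haveI := Literature.NumberTheory.GaloisRepresentations.charZero_adicCompletion v
  set P : Subgroup (v.adicCompletion F)ˣ :=
    ((powMonoidHom n : (↥(v.adicCompletionIntegers F))ˣ →* _).range).map (unitsToK v) with hP
  have hv : (Valued.v : Valuation (v.adicCompletion F) (WithZero (Multiplicative ℤ))).Integers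
      (v.adicCompletionIntegers F) := Valuation.valuationSubring.integers _
  -- the scale `c = n²` and the neighbourhood `U = {x : ‖x - 1‖ < ‖c‖}` of `1`
  set c : v.adicCompletion F := ((n : ℕ) : v.adicCompletion F) ^ 2 with hc
  have hc0 : c ≠ 0 := pow_ne_zero _ (by exact_mod_cast hn)
  have hcpos : 0 < ‖c‖ := norm_pos_iff.mpr hc0
  apply Subgroup.isOpen_of_mem_nhds P (g := 1)
  have hU : IsOpen {x : (v.adicCompletion F)ˣ | ‖(x : v.adicCompletion F) - 1‖ < ‖c‖} := by
    have : {x : (v.adicCompletion F)ˣ | ‖(x : v.adicCompletion F) - 1‖ < ‖c‖} =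
        Units.val ⁻¹' Metric.ball (1 : v.adicCompletion F) ‖c‖ := by
      ext x; simp [Metric.ball, dist_eq_norm]
    rw [this]; exact Metric.isOpen_ball.preimage Units.continuous_val
  refine mem_nhds_iff.mpr ⟨_, ?_, hU, ?_⟩
  swap
  · show ‖(((1 : (v.adicCompletion F)ˣ) : (v.adicCompletion F)ˣ) : v.adicCompletion F) - 1‖ < ‖c‖
    rw [Units.val_one, sub_self, norm_zero]; exact hcpos
  intro x hx
  simp only [Set.mem_setOf_eq] at hx
  -- `w := (x - 1)/c` lies in the maximal ideal of `𝒪_v`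
  set w : v.adicCompletion F := ((x : v.adicCompletion F) - 1) / c with hw
  have hwlt : Valued.v w < 1 := by
    have : ‖w‖ < 1 := by
      rw [hw, norm_div, div_lt_one hcpos]; exact hx
    exact Valued.toNormedField.norm_lt_one_iff.mp this
  have hwO : w ∈ v.adicCompletionIntegers F := by
    rw [HeightOneSpectrum.mem_adicCompletionIntegers]; exact hwlt.le
  have hwm : (⟨w, hwO⟩ : ↥(v.adicCompletionIntegers F)) ∈ IsLocalRing.maximalIdeal (↥(v.adicCompletionIntegers F)) := by
    rw [IsLocalRing.mem_maximalIdeal, mem_nonunits_iff, hv.isUnit_iff_valuation_eq_one]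
    exact hwlt.ne
  -- Hensel: `1 + n² w = uⁿ` for a unit `u` of `𝒪_v`
  obtain ⟨u, hu, -⟩ := exists_units_pow_eq_one_add n hwm
  have hval : (((u : ↥(v.adicCompletionIntegers F)) : v.adicCompletion F)) ^ n = (x : v.adicCompletion F) := by
    have h := congrArg (fun z : ↥(v.adicCompletionIntegers F) => (z : v.adicCompletion F)) hu
    simp only [SubmonoidClass.coe_pow] at h
    rw [h]
    push_cast
    rw [hw, hc, mul_div_cancel₀ _ hc0, add_sub_cancel]
  refine ⟨u ^ n, ⟨u, rfl⟩, Units.ext ?_⟩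
  rw [coe_unitsToK]
  push_cast
  exact hval

/-! ## 2. Sub-lattices between `n·Λ` and `Λ` are fixed; the scalar-mod-`n` form -/

variable {v}
variable (L : Additive (↥(v.adicCompletionIntegers F))ˣ →+ v.adicCompletion F)
  {φ : MulAut (ModTorsion (OUnits v))} (hφ : φ ∈ ismGenuine v)
  {ψ : v.adicCompletion F ≃+ v.adicCompletion F} (hψ : Realises v L φ ψ)

/-- `n`-th powers of units lie in the unit preimage of any `M ∋ n·L(u)`. [folklore] -/
theorem range_powMonoidHom_le_unitPreimage {n : ℕ} (M : AddSubgroup (v.adicCompletion F))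
    (hnM : ∀ u : (↥(v.adicCompletionIntegers F))ˣ, n • L (Additive.ofMul u) ∈ M) :
    (powMonoidHom n : (↥(v.adicCompletionIntegers F))ˣ →* _).range ≤ unitPreimage L M := by
  rintro _ ⟨u, rfl⟩
  rw [mem_unitPreimage_iff, powMonoidHom_apply, ofMul_pow, map_nsmul]
  exact hnM u

include hφ hψ

/-- **PRINT'S (Ind2) FIXES EVERY SUB-LATTICE BETWEEN `n·Λ` AND `Λ`** (`Λ = L(𝒪_v^×)`, `n ≠ 0`): for `ψ` realising a
`G_v`-isometry through `L` and an additive subgroup `M ⊆ Λ` containing `n·L(u)` for every unit `u`: `ψ(M) = M`.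
(The unit preimage of `M` contains the open subgroup `(𝒪_v^×)^n`, so `Thm311RealInd2IsmRigid`'s
`image_eq_of_realises_of_le_range` applies.) [cite: SerreLocalFields1979, Ch. XIV §6 Thm. 1] [claim: Mochizuki2012, status: disputed] -/
theorem image_eq_of_realises_of_nsmul_mem {n : ℕ} (hn : n ≠ 0) (M : AddSubgroup (v.adicCompletion F))
    (hM : (M : Set (v.adicCompletion F)) ⊆ Set.range fun u : (↥(v.adicCompletionIntegers F))ˣ => L (Additive.ofMul u))
    (hnM : ∀ u : (↥(v.adicCompletionIntegers F))ˣ, n • L (Additive.ofMul u) ∈ M) :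
    ψ '' (M : Set (v.adicCompletion F)) = M :=
  image_eq_of_realises_of_le_range L hφ hψ M hM
    (Subgroup.isOpen_mono (Subgroup.map_mono (range_powMonoidHom_le_unitPreimage L M hnM))
      (isOpen_map_range_powMonoidHom v hn))

/-- The sub-lattice `ℤ·L(u) + n·Λ` generated by one direction modulo `n`. [folklore] -/
def directionMod (u : (↥(v.adicCompletionIntegers F))ˣ) (n : ℕ) : AddSubgroup (v.adicCompletion F) where
  carrier := {a | ∃ (k : ℤ) (u' : (↥(v.adicCompletionIntegers F))ˣ), a = k • L (Additive.ofMul u) + n • L (Additive.ofMul u')}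
  zero_mem' := ⟨0, 1, by simp⟩
  add_mem' := by
    rintro _ _ ⟨k₁, u₁, rfl⟩ ⟨k₂, u₂, rfl⟩
    refine ⟨k₁ + k₂, u₁ * u₂, ?_⟩
    rw [ofMul_mul, map_add, add_smul, smul_add]; abel
  neg_mem' := by
    rintro _ ⟨k, u', rfl⟩
    refine ⟨-k, u'⁻¹, ?_⟩
    rw [ofMul_inv, map_neg, neg_smul, smul_neg, neg_add]

omit hφ hψ in
/-- Membership in `directionMod`. [folklore] -/
theorem mem_directionMod_iff (u : (↥(v.adicCompletionIntegers F))ˣ) (n : ℕ) (a : v.adicCompletion F) :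
    a ∈ directionMod L u n ↔
      ∃ (k : ℤ) (u' : (↥(v.adicCompletionIntegers F))ˣ), a = k • L (Additive.ofMul u) + n • L (Additive.ofMul u') :=
  Iff.rfl

/-- **PRINT'S Ism IS A SCALAR MODULO EVERY `n` ON THE LOG-LATTICE**: for `ψ` realising a `G_v`-isometry through `L`,
every unit `u` and every `n ≠ 0` there are `k ∈ ℤ` and a unit `u'` with `ψ(L u) = k·L(u) + n·L(u')` — `ψ` preserves
every direction of `Λ = L(𝒪_v^×)` modulo `nΛ` (take `M := ℤ·L(u) + n·Λ` in `image_eq_of_realises_of_nsmul_mem`).  So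
PRINT's (Ind2) at `v` never SHEARS the log-lattice: modulo every `n` it acts on each cyclic direction by an
integer, whereas Dupuy–Hilado's `Aut_{ℚ_p}(K_v : I_v) = GL_{ℤ_p}(I_v)` (`Real.ismDH`) moves directions as soon as
`[K_v : ℚ_p] ≥ 2`. [cite: SerreLocalFields1979, Ch. XIV §6 Thm. 1] [claim: Mochizuki2012, status: disputed] -/
theorem exists_zsmul_add_nsmul_of_realises {n : ℕ} (hn : n ≠ 0) (u : (↥(v.adicCompletionIntegers F))ˣ) :
    ∃ (k : ℤ) (u' : (↥(v.adicCompletionIntegers F))ˣ),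
      ψ (L (Additive.ofMul u)) = k • L (Additive.ofMul u) + n • L (Additive.ofMul u') := by
  have hM : ((directionMod L u n : AddSubgroup _) : Set (v.adicCompletion F)) ⊆
      Set.range fun w : (↥(v.adicCompletionIntegers F))ˣ => L (Additive.ofMul w) := by
    rintro _ ⟨k, u', rfl⟩
    refine ⟨u ^ k * u' ^ n, ?_⟩
    simp only [ofMul_mul, ofMul_zpow, ofMul_pow, map_add, map_zsmul, map_nsmul]
  have hnM : ∀ w : (↥(v.adicCompletionIntegers F))ˣ, n • L (Additive.ofMul w) ∈ directionMod L u n :=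
    fun w => ⟨0, w, by simp⟩
  have hfix := image_eq_of_realises_of_nsmul_mem L hφ hψ hn (directionMod L u n) hM hnM
  have hmem : ψ (L (Additive.ofMul u)) ∈ (directionMod L u n : Set (v.adicCompletion F)) := by
    rw [← hfix]
    exact ⟨L (Additive.ofMul u), ⟨1, 1, by simp⟩, rfl⟩
  exact hmem

omit hφ hψ in
/-- **Every element of print's (Ind2)-group at `v` is a scalar modulo every `n` on the log-lattice** (the form over
`Real.ismIsmOf v L`, the set of ALL realised isometries). [cite: SerreLocalFields1979, Ch. XIV §6 Thm. 1] [claim: Mochizuki2012, status: disputed] -/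
theorem exists_zsmul_add_nsmul_of_mem_ismIsmOf {ψ' : v.adicCompletion F ≃+ v.adicCompletion F}
    (hψ' : ψ' ∈ ismIsmOf v L) {n : ℕ} (hn : n ≠ 0) (u : (↥(v.adicCompletionIntegers F))ˣ) :
    ∃ (k : ℤ) (u' : (↥(v.adicCompletionIntegers F))ˣ),
      ψ' (L (Additive.ofMul u)) = k • L (Additive.ofMul u) + n • L (Additive.ofMul u') := by
  obtain ⟨-, -, φ', hφ', hr⟩ := hψ'
  exact exists_zsmul_add_nsmul_of_realises L hφ' hr hn u

omit hφ hψ in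
/-- **NO-SHEAR CRITERION** (contrapositive, for citation by the adjudication teams): an automorphism `ψ'` of `K_v` that
moves some direction of the log-lattice modulo some `n ≠ 0` — `ψ'(L u) ∉ ℤ·L(u) + n·L(𝒪_v^×)` — is NOT in print's
(Ind2)-group `Real.ismIsmOf v L`, whatever its continuity or its effect on `I_v` (so a lattice shear in Dupuy–Hilado's
`Aut_{ℚ_p}(K_v : I_v)` realises no `G_v`-isometry). [cite: SerreLocalFields1979, Ch. XIV §6 Thm. 1] [claim: Mochizuki2012, status: disputed] -/
theorem not_mem_ismIsmOf_of_moves_direction {ψ' : v.adicCompletion F ≃+ v.adicCompletion F} {n : ℕ} (hn : n ≠ 0)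
    (u : (↥(v.adicCompletionIntegers F))ˣ)
    (hmove : ∀ (k : ℤ) (u' : (↥(v.adicCompletionIntegers F))ˣ),
      ψ' (L (Additive.ofMul u)) ≠ k • L (Additive.ofMul u) + n • L (Additive.ofMul u')) :
    ψ' ∉ ismIsmOf v L := fun h => by
  obtain ⟨k, u', hk⟩ := exists_zsmul_add_nsmul_of_mem_ismIsmOf L h hn u
  exact hmove k u' hk

end Summit.ABC.IUTFork.Thm311.Real

end
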